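import Summits.CriticalPhenomena.PercolationContinuityZ3.Theorems.PercNearOneGluingNoHeavyLowerTailSahiSharedCubeHybrid
import Summits.CriticalPhenomena.PercolationContinuityZ3.Theorems.PercNearOneGluingNoHeavyLowerTailSahiCubePhiPolarised
import Mathlib.Tactic.Linarith
import Mathlib.Tactic.Ring
import HarnessLib

/-!
# `NoHeavyLowerTail` (crux stmt-CriticalPhenomena-4575), master-family line P2 — **THE λ = 2 RUNG ON CLASS T**:
# at every coordinate `e` of the `f`–`g` block of a class-T triple, `E_3(μ_p) ≥ p_e²·E_3(μ_{p[e↦1]}) + (1−p_e)²·E_3(μ_{p[e↦0]})`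

Support file (seat `prim-masterthm-p2`, gen 14; `--supports stmt-CriticalPhenomena-4575`).  No definition, no `sorry`, standard axioms.
Memo SAHI-ROUTE.md §4.33 (block comb-positivity on class T: the ratio proof POLARISES) and §4.36(j) ("λ = 2 holds on class T").

SETTING (as in `…SahiTriangleClassT` / `…SahiSharedCubeHybrid`).  `α, β` finite distributive lattices with FKG probability weights `wA, wB`;
the block shared by `f` and `g` is the cube `Finset ι` with a log-modular probability weight `w` (every product Bernoulli weight);
`f(c,a)`, `g(c,b)`, `h(a,b) ≥ 0` monotone in every argument — CLASS T: the third member ignores the `f`–`g` block (for increasing events on a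
cube: no coordinate is essential to all three events).  Sahi's `C_3` holds on class T (`SahiTriangleClassT.sahiE_three_nonneg_triangle`, gen 8).

THE ONE-COORDINATE PICTURE.  Along a coordinate `e` of the `f`–`g` block the fibre `s ↦ E(s) := E_3(μ_{p[e↦s]})` is a QUADRATIC
`β₀(1−s)² + 2β₁s(1−s) + β₂s²` (the third member is `e`-free), `β₀ = E(0)`, `β₂ = E(1)` are `E_3`'s of the sections (class T again, so `≥ 0`),
and the census-clean single-coordinate forms of the programme at such a 2-shared coordinate ALL reduce to the sign of the mixed coefficient:
master-conj's BGC, the λ = 2 rung `3B₁ ≥ B₀` / `3B₂ ≥ B₃` of the antitone ladder (SAHI-ROUTE §4.36(g),(j); in cubic Bernstein form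
`MC1 = MC2 = 2β₁`), bnk-2's two-level laws `SahiTwoLevelMinus` / `SahiTwoLevelPlus` at these sections, and (f1) of §4.34(e) are each `β₁(e) ≥ 0`,
i.e. `E(s) ≥ s²E(1) + (1−s)²E(0)`.  (The λ = 1 rung `E(s) ≥ sE(1)` = (T3∀) is FALSE already on class T: `…SahiCoordinateTwoThirdsFalse`.)

* `sq_mul_sahiE_three_add_le` — **THEOREM.**  For `e ∈ ι`, `t ∈ [0,1]` and probability weights `w¹, w⁰` on the cube with `t·w¹ = 1_{e∈·}·w`,
  `(1−t)·w⁰ = 1_{e∉·}·w` (for `w = μ_p`: `t = p_e`, `w¹ = μ_{p[e↦1]}`, `w⁰ = μ_{p[e↦0]}`):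
    `t²·E_3(wA ⊗ wB ⊗ w¹; f,g,h) + (1−t)²·E_3(wA ⊗ wB ⊗ w⁰; f,g,h) ≤ E_3(wA ⊗ wB ⊗ w; f,g,h)`.
* (companion file `…SahiClassTLambdaTwoCubes`) `sq_mul_sahiE_three_add_le_cubes` — the same for three Boolean cubes `2^C × 2^A × 2^B` with product Bernoulli weights and `Function.update`:
    `p_e²·E_3(μ_{p[e↦1]}) + (1−p_e)²·E_3(μ_{p[e↦0]}) ≤ E_3(μ_p)` for every `e ∈ C`, all monotone nonnegative `f : 2^C × 2^A → ℝ`, `g : 2^C × 2^B → ℝ`,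
  `h : 2^A × 2^B → ℝ`; corollaries `sq_mul_sahiE_three_one_le_cubes` (`E_3(μ_p) ≥ p_e²·E_3(μ_{p[e↦1]})`: "conditioning the three members on
  `x_e = 1` costs at most the factor `p_e^{−2}`") and `sq_mul_sahiE_three_zero_le_cubes` (`E_3(μ_p) ≥ (1−p_e)²·E_3(μ_{p[e↦0]})`).
  By the symmetry of `E_3` and of class T the same holds at the coordinates of the `f`–`h` and `g`–`h` blocks (apply the theorem to the permuted
  triple), i.e. at EVERY coordinate of a class-T triple on cubes.

PROOF (new assembly of tree ingredients).  The class-T hybrid identity with the class-T ratio `ρ(c) = F(c)H̄/Ȳ(c)` (weight-free on the cube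
block; its defect `ψ_ρ` vanishes under every probability weight, `psiOf_eq_zero`) reads, for EVERY probability weight `w` on the cube,
  `E_3(w) = Σ_b wB(b)·Σ_{x,y} w(x)w(y)T_b(x,y) + Σ_c w(c)ρ(c)K(c) + Σ_{x,y} w(x)w(y)(1−ρ(x))L(x,y)`      (`sahiE_three_eq_pieces`)
with WEIGHT-FREE kernels `T_b(x,y) = g(x,b)[(2−ρ_x)Y(x,b) − F(y)H(b) − (1−ρ_y)Y(y,b)]`, `K(c) = Cov_b(g(c,·),Y(c,·)) ≥ 0`, `L(x,y) = Cov_b(g(y,·),Y(x,·)) ≥ 0`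
(`SahiSharedTwoPoint.sahiE_three_eq_of_ratio`, `SahiBox.phi_eq_double_sum`).  Since `t²·w¹⊗w¹ = 1_{e ∈ x∩y}·w⊗w` and `(1−t)²·w⁰⊗w⁰ = 1_{e ∉ x∪y}·w⊗w`,
the difference `E_3(w) − t²E_3(w¹) − (1−t)²E_3(w⁰)` is the MIXED part (`e` in exactly one of `x, y`) of each piece: for `T_b` it is `≥ 0` by the
POLARISED `G3` (`SahiBox.phi_polarised_coord_mixed`, p274791: the antipodal lemma box by box, boxes spanning `e`); for `K` it is
`Σ_c [(1−t)1_{e∈c} + t1_{e∉c}]w(c)ρ(c)K(c) ≥ 0`; for `L` it is termwise `≥ 0` (FKG on `β`).  Everything here is proved; axioms standard.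
HONEST FRAMING: BGC-all / `SahiTwoLevelPlus` / Kahn's `C_3` OFF class T remain OPEN (census: λ = 2 and BGC-all have 0 failures on the exhaustive
`k = 5` grid and hold for all `p` at `k = 5` by ttrl's exhaustive MC-comb census, lane `run/shared/lean/ttrl/mtp2/T3.md` §5); the antitone exponent of
class T lies in `[9/8, 2]` (§4.36(j): the five-coin family gives `9/8`, this file gives `2`). [this work]
-/

noncomputable section

open scoped Classical

namespace Summit.CriticalPhenomena.PercolationContinuityZ3.Theorems

namespace SahiClassTLambdaTwo

open Finset
open Literature.Combinatorics.Sahi2008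

/-! ### Generic one-coordinate polarisation of pair sums and linear sums on the cube `Finset ι` -/

section Polar

variable {ι : Type} [DecidableEq ι] [Fintype ι]

/-- `t²·Σ_{x,y} w¹(x)w¹(y)M(x,y)` is the TOP part (`e ∈ x ∩ y`) of the pair sum against `w ⊗ w` when `t·w¹ = 1_{e∈·}·w`. [this work] -/
theorem sq_mul_pairSum_top (e : ι) (t : ℝ) (w w1 : Finset ι → ℝ) (h1 : ∀ x, t * w1 x = if e ∈ x then w x else 0)
    (M : Finset ι → Finset ι → ℝ) :
    t ^ 2 * ∑ x, ∑ y, w1 x * w1 y * M x y = ∑ x, ∑ y, (if e ∈ x ∩ y then w x * w y else 0) * M x y := by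
  rw [mul_sum]
  refine sum_congr rfl fun x _ => ?_
  rw [mul_sum]
  refine sum_congr rfl fun y _ => ?_
  have e1 : t ^ 2 * (w1 x * w1 y * M x y) = (t * w1 x) * (t * w1 y) * M x y := by ring
  rw [e1, h1 x, h1 y]
  by_cases hx : e ∈ x <;> by_cases hy : e ∈ y <;> simp [hx, hy, mem_inter]

/-- `(1−t)²·Σ_{x,y} w⁰(x)w⁰(y)M(x,y)` is the BOTTOM part (`e ∉ x ∪ y`) when `(1−t)·w⁰ = 1_{e∉·}·w`. [this work] -/
theorem sq_mul_pairSum_bottom (e : ι) (t : ℝ) (w w0 : Finset ι → ℝ)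
    (h0 : ∀ x, (1 - t) * w0 x = if e ∈ x then 0 else w x) (M : Finset ι → Finset ι → ℝ) :
    (1 - t) ^ 2 * ∑ x, ∑ y, w0 x * w0 y * M x y = ∑ x, ∑ y, (if e ∉ x ∪ y then w x * w y else 0) * M x y := by
  rw [mul_sum]
  refine sum_congr rfl fun x _ => ?_
  rw [mul_sum]
  refine sum_congr rfl fun y _ => ?_
  have e1 : (1 - t) ^ 2 * (w0 x * w0 y * M x y) = ((1 - t) * w0 x) * ((1 - t) * w0 y) * M x y := by ring
  rw [e1, h0 x, h0 y]
  by_cases hx : e ∈ x <;> by_cases hy : e ∈ y <;> simp [hx, hy, mem_union]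

/-- The pair sum against `w ⊗ w` splits into its top, bottom and MIXED parts along `e`. [this work] -/
theorem pairSum_split (e : ι) (w : Finset ι → ℝ) (M : Finset ι → Finset ι → ℝ) :
    ∑ x, ∑ y, w x * w y * M x y =
      (∑ x, ∑ y, (if e ∈ x ∩ y then w x * w y else 0) * M x y) +
      (∑ x, ∑ y, (if e ∉ x ∪ y then w x * w y else 0) * M x y) +
      ∑ x, ∑ y, (if e ∈ x ∪ y ∧ e ∉ x ∩ y then w x * w y else 0) * M x y := by
  rw [← sum_add_distrib, ← sum_add_distrib]
  refine sum_congr rfl fun x _ => ?_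
  rw [← sum_add_distrib, ← sum_add_distrib]
  refine sum_congr rfl fun y _ => ?_
  by_cases hx : e ∈ x <;> by_cases hy : e ∈ y <;> simp [hx, hy, mem_inter, mem_union]

/-- `t·Σ_c w¹(c)m(c)` is the `e ∈ c` part of `Σ_c w(c)m(c)`. [this work] -/
theorem mul_linSum_top (e : ι) (t : ℝ) (w w1 : Finset ι → ℝ) (h1 : ∀ x, t * w1 x = if e ∈ x then w x else 0)
    (m : Finset ι → ℝ) : t * ∑ c, w1 c * m c = ∑ c, (if e ∈ c then w c else 0) * m c := by
  rw [mul_sum]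
  exact sum_congr rfl fun c _ => by rw [← mul_assoc, h1 c]

/-- `(1−t)·Σ_c w⁰(c)m(c)` is the `e ∉ c` part of `Σ_c w(c)m(c)`. [this work] -/
theorem mul_linSum_bottom (e : ι) (t : ℝ) (w w0 : Finset ι → ℝ) (h0 : ∀ x, (1 - t) * w0 x = if e ∈ x then 0 else w x)
    (m : Finset ι → ℝ) : (1 - t) * ∑ c, w0 c * m c = ∑ c, (if e ∈ c then 0 else w c) * m c := by
  rw [mul_sum]
  exact sum_congr rfl fun c _ => by rw [← mul_assoc, h0 c]

end Polar

/-! ### Class T on `α × β × 2^ι`: the pieces of the hybrid identity are weight-free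

Statements use the class-T vocabulary of `…SahiTriangleClassT` (`Y(c,b) = E_a[f(c,a)h(a,b)]`, `FC(c) = E_a f(c,a)`, `HH(b) = E_a h(a,b)`,
`GC(c) = E_b g(c,b)`, `Ybar(c) = E_b Y(c,b)`, the ratio `rho(c) = FC(c)·H̄/Ybar(c)`); the proofs run the general identity of
`…SahiSharedTwoPointIdentity` with the third member `fun _ a b => h a b` (constant on the cube block), whose moments are the class-T ones by `rfl`. -/

section ClassT

open SahiTriangleClassT (Y FC HH GC Ybar Hbar rho)

variable {ι α β : Type} [DecidableEq ι] [Fintype ι] [Fintype α] [Fintype β]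
  {wA : α → ℝ} {wB : β → ℝ} {f : Finset ι → α → ℝ} {g : Finset ι → β → ℝ} {h : α → β → ℝ}

omit [DecidableEq ι] in
/-- For class T the defect of the class-T ratio vanishes under every probability weight on the cube block:
`ψ_ρ(c) = EH·F(c) − ρ(c)Ȳ(c) = 0`. [this work] -/
theorem psiOf_eq_zero [DistribLattice α] (hA : IsFKGMeasure wA) (hB0 : ∀ b, 0 ≤ wB b)
    (hf0 : ∀ c a, 0 ≤ f c a) (hh0 : ∀ a b, 0 ≤ h a b) (hfa : ∀ c, Monotone (f c)) (hha : ∀ b, Monotone (fun a => h a b))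
    (w : Finset ι → ℝ) (hw1 : ∑ x, w x = 1) (c : Finset ι) :
    SahiSharedTwoPoint.psiOf wA wB w f (fun (_ : Finset ι) (a : α) (b : β) => h a b) (rho wA wB f h) c = 0 := by
  have key := (SahiTriangleClassT.rho_spec (wB := wB) hA hB0 hf0 hh0 hfa hha c).1
  have hEH : SahiSharedTwoPoint.EH wA wB w (fun (_ : Finset ι) (a : α) (b : β) => h a b) = Hbar wA wB h := by
    unfold SahiSharedTwoPoint.EH
    have hc : ∀ c', SahiSharedTwoPoint.Hbar wA wB (fun (_ : Finset ι) (a : α) (b : β) => h a b) c' = Hbar wA wB h := fun c' => rfl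
    simp only [hc, ← sum_mul, hw1, one_mul]
  have hY : SahiSharedTwoPoint.Ybar wA wB f (fun (_ : Finset ι) (a : α) (b : β) => h a b) c = Ybar wA wB f h c := rfl
  have hF : SahiSharedTwoPoint.FC wA f c = FC wA f c := rfl
  unfold SahiSharedTwoPoint.psiOf
  rw [hEH, hY, hF, key]
  ring

omit [DecidableEq ι] in
/-- Hence the defect kernel `Δ_ρ` vanishes identically. [this work] -/
theorem deltaOf_eq_zero [DistribLattice α] (hA : IsFKGMeasure wA) (hB0 : ∀ b, 0 ≤ wB b)
    (hf0 : ∀ c a, 0 ≤ f c a) (hh0 : ∀ a b, 0 ≤ h a b) (hfa : ∀ c, Monotone (f c)) (hha : ∀ b, Monotone (fun a => h a b))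
    (w : Finset ι → ℝ) (hw1 : ∑ x, w x = 1) (b : β) :
    SahiSharedTwoPoint.DeltaOf wA wB w f g (fun (_ : Finset ι) (a : α) (b : β) => h a b) (rho wA wB f h) b = 0 := by
  unfold SahiSharedTwoPoint.DeltaOf
  simp only [psiOf_eq_zero hA hB0 hf0 hh0 hfa hha w hw1, mul_zero, sum_const_zero, sub_self]

omit [DecidableEq ι] in
/-- The Φ-kernel as a pair sum against `w ⊗ w` of the weight-free kernel
`T_b(x,y) = g(x,b)[(2−ρ_x)Y(x,b) − F(y)H(b) − (1−ρ_y)Y(y,b)]`. [this work] -/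
theorem phiOf_eq_pairSum (w : Finset ι → ℝ) (hw1 : ∑ x, w x = 1) (b : β) :
    SahiSharedTwoPoint.PhiOf wA w f g (fun (_ : Finset ι) (a : α) (b : β) => h a b) (rho wA wB f h) b =
      ∑ x, ∑ y, w x * w y * (g x b * ((2 - rho wA wB f h x) * Y wA f h x b
        - FC wA f y * HH wA h b - (1 - rho wA wB f h y) * Y wA f h y b)) := by
  unfold SahiSharedTwoPoint.PhiOf SahiSharedTwoPoint.EF SahiSharedTwoPoint.GG
  exact SahiBox.phi_eq_double_sum w (FC wA f) (fun _ => HH wA h b) (fun c => Y wA f h c b) (rho wA wB f h)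
    (fun c => g c b) hw1

omit [DecidableEq ι] in
/-- The second covariance term as a `w`-mixture of the weight-free covariances `L(c,c') = Cov_b(g(c',·), Y(c,·))`. [this work] -/
theorem covTwo_eq_linSum (w : Finset ι → ℝ) (c : Finset ι) :
    (∑ b, wB b * (SahiSharedTwoPoint.GG w g b * SahiSharedTwoPoint.Y wA f (fun (_ : Finset ι) (a : α) (b : β) => h a b) c b))
        - SahiSharedTwoPoint.Gbar wB w g * SahiSharedTwoPoint.Ybar wA wB f (fun (_ : Finset ι) (a : α) (b : β) => h a b) c =
      ∑ c', w c' * ((∑ b, wB b * (g c' b * Y wA f h c b)) - GC wB g c' * Ybar wA wB f h c) := by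
  have hY : SahiSharedTwoPoint.Y wA f (fun (_ : Finset ι) (a : α) (b : β) => h a b) = Y wA f h := rfl
  have hYb : SahiSharedTwoPoint.Ybar wA wB f (fun (_ : Finset ι) (a : α) (b : β) => h a b) = Ybar wA wB f h := rfl
  have e1 : (∑ b, wB b * (SahiSharedTwoPoint.GG w g b * Y wA f h c b)) =
      ∑ c', w c' * ∑ b, wB b * (g c' b * Y wA f h c b) := by
    unfold SahiSharedTwoPoint.GG
    rw [← SahiTriangleClassT.swap_bc wB w (fun b c' => g c' b * Y wA f h c b)]
    refine sum_congr rfl fun b _ => ?_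
    rw [sum_mul, mul_sum, mul_sum]
    exact sum_congr rfl fun c' _ => by ring
  have e2 : SahiSharedTwoPoint.Gbar wB w g = ∑ c', w c' * GC wB g c' := by
    unfold SahiSharedTwoPoint.Gbar SahiSharedTwoPoint.GG GC
    exact SahiTriangleClassT.swap_bc wB w (fun b c' => g c' b)
  rw [hY, hYb, e1, e2, sum_mul, ← sum_sub_distrib]
  exact sum_congr rfl fun c' _ => by ring

omit [DecidableEq ι] in
/-- **The class-T hybrid identity with weight-free pieces.**  For every probability weight `w` on the cube block,
`E_3(wA ⊗ wB ⊗ w; f,g,h) = Σ_b wB(b)·Σ_{x,y} w(x)w(y)T_b(x,y) + Σ_c w(c)ρ(c)K(c) + Σ_{x,y} w(x)w(y)(1−ρ(x))L(x,y)` with the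
WEIGHT-FREE kernels `T_b(x,y) = g(x,b)[(2−ρ_x)Y(x,b) − F(y)H(b) − (1−ρ_y)Y(y,b)]`, `K(c) = Cov_b(g(c,·),Y(c,·))`,
`L(x,y) = Cov_b(g(y,·),Y(x,·))` (from `SahiSharedTwoPoint.sahiE_three_eq_of_ratio` with the class-T ratio, whose defect vanishes). [this work] -/
theorem sahiE_three_eq_pieces [DistribLattice α] [DistribLattice β] (hA : IsFKGMeasure wA) (hB : IsFKGMeasure wB)
    (hf0 : ∀ c a, 0 ≤ f c a) (hh0 : ∀ a b, 0 ≤ h a b) (hfa : ∀ c, Monotone (f c)) (hha : ∀ b, Monotone (fun a => h a b))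
    (w : Finset ι → ℝ) (hw1 : ∑ x, w x = 1) :
    sahiE (fun q : α × β × Finset ι => wA q.1 * wB q.2.1 * w q.2.2) 3
        ![fun q => f q.2.2 q.1, fun q => g q.2.2 q.2.1, fun q => h q.1 q.2.1] =
      (∑ b, wB b * ∑ x, ∑ y, w x * w y *
          (g x b * ((2 - rho wA wB f h x) * Y wA f h x b - FC wA f y * HH wA h b - (1 - rho wA wB f h y) * Y wA f h y b))) +
      ((∑ c, w c * (rho wA wB f h c * ((∑ b, wB b * (g c b * Y wA f h c b)) - GC wB g c * Ybar wA wB f h c))) +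
        ∑ x, ∑ y, w x * w y *
          ((1 - rho wA wB f h x) * ((∑ b, wB b * (g y b * Y wA f h x b)) - GC wB g y * Ybar wA wB f h x))) := by
  have key := SahiSharedTwoPoint.sahiE_three_eq_of_ratio (wA := wA) (wB := wB) (wC := w) (f := f) (g := g)
    (h := (fun (_ : Finset ι) (a : α) (b : β) => h a b)) (rho wA wB f h) hA.sum_eq_one hB.sum_eq_one
  refine key.trans ?_
  have hΦ : ∀ b, SahiSharedTwoPoint.PhiOf wA w f g (fun (_ : Finset ι) (a : α) (b : β) => h a b) (rho wA wB f h) b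
        + SahiSharedTwoPoint.DeltaOf wA wB w f g (fun (_ : Finset ι) (a : α) (b : β) => h a b) (rho wA wB f h) b =
      ∑ x, ∑ y, w x * w y *
        (g x b * ((2 - rho wA wB f h x) * Y wA f h x b - FC wA f y * HH wA h b - (1 - rho wA wB f h y) * Y wA f h y b)) := by
    intro b
    rw [deltaOf_eq_zero hA hB.nonneg hf0 hh0 hfa hha w hw1, add_zero, phiOf_eq_pairSum w hw1]
  have hY : SahiSharedTwoPoint.Y wA f (fun (_ : Finset ι) (a : α) (b : β) => h a b) = Y wA f h := rfl
  have hYb : SahiSharedTwoPoint.Ybar wA wB f (fun (_ : Finset ι) (a : α) (b : β) => h a b) = Ybar wA wB f h := rfl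
  have hGC : SahiSharedTwoPoint.GC wB g = GC wB g := rfl
  simp only [hΦ, covTwo_eq_linSum]
  simp only [hY, hYb, hGC]
  congr 1
  rw [← sum_add_distrib]
  refine sum_congr rfl fun c _ => ?_
  rw [mul_add, mul_sum, mul_sum]
  congr 1
  exact sum_congr rfl fun c' _ => by ring

/-- **THEOREM (the λ = 2 rung / mixed Bernstein component on class T).**  `α, β` finite distributive lattices with FKG probability
weights `wA, wB`; the block shared by `f` and `g` is the cube `2^ι` with a log-modular probability weight `w`; `f(c,a)`, `g(c,b)`, `h(a,b) ≥ 0`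
monotone in every argument (CLASS T: the third member ignores the `f`–`g` block).  Let `e ∈ ι`, `t ∈ [0,1]`, and let `w¹`, `w⁰` be
probability weights with `t·w¹ = 1_{e ∈ ·}·w`, `(1−t)·w⁰ = 1_{e ∉ ·}·w` (for the product weight `μ_p`: `t = p_e`, `w¹ = μ_{p[e↦1]}`,
`w⁰ = μ_{p[e↦0]}`).  Then
  `t²·E_3(w¹) + (1−t)²·E_3(w⁰) ≤ E_3(w)`.
For the (quadratic) fibre `t ↦ E_3(μ_{p[e↦t]}) = β₀(1−t)² + 2β₁t(1−t) + β₂t²` this is `β₁(e) ≥ 0`: BGC at `e`, and the λ = 2 forms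
`3B₁(e) ≥ B₀(e)`, `3B₂(e) ≥ B₃(e)` (`MC1 = MC2 = 2β₁` at a 2-shared coordinate; bnk-2's `SahiTwoLevelMinus/Plus` at these sections).
PROOF: `sahiE_three_eq_pieces` at the three weights; `t²(w¹⊗w¹) = 1_{top}(w⊗w)`, `(1−t)²(w⁰⊗w⁰) = 1_{bottom}(w⊗w)`, so the difference is the
MIXED part of each piece: `Σ_b wB·(mixed part of Φ_b) ≥ 0` by the polarised `G3` (`SahiBox.phi_polarised_coord_mixed`),
`Σ_c [(1−t)1_{e∈c} + t1_{e∉c}] w(c)ρ(c)K(c) ≥ 0` and the mixed part of the `L`-sum `≥ 0` termwise (FKG on `β`).  SAHI-ROUTE §4.33, §4.36(j). [this work] -/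
theorem sq_mul_sahiE_three_add_le [DistribLattice α] [DistribLattice β] (hA : IsFKGMeasure wA) (hB : IsFKGMeasure wB)
    (hf0 : ∀ c a, 0 ≤ f c a) (hfa : ∀ c, Monotone (f c)) (hfc : ∀ a, Monotone (fun c => f c a))
    (hg0 : ∀ c b, 0 ≤ g c b) (hgb : ∀ c, Monotone (g c)) (hgc : ∀ b, Monotone (fun c => g c b))
    (hh0 : ∀ a b, 0 ≤ h a b) (hha : ∀ b, Monotone (fun a => h a b)) (hhb : ∀ a, Monotone (h a))
    (e : ι) {t : ℝ} (ht0 : 0 ≤ t) (ht1 : t ≤ 1) {w w1 w0 : Finset ι → ℝ} (hw0 : ∀ x, 0 ≤ w x) (hws : ∑ x, w x = 1)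
    (hwmod : ∀ x y, w x * w y = w (x ∩ y) * w (x ∪ y)) (hw1s : ∑ x, w1 x = 1) (hw0s : ∑ x, w0 x = 1)
    (h1 : ∀ x, t * w1 x = if e ∈ x then w x else 0) (h0 : ∀ x, (1 - t) * w0 x = if e ∈ x then 0 else w x) :
    t ^ 2 * sahiE (fun q : α × β × Finset ι => wA q.1 * wB q.2.1 * w1 q.2.2) 3
          ![fun q => f q.2.2 q.1, fun q => g q.2.2 q.2.1, fun q => h q.1 q.2.1] +
      (1 - t) ^ 2 * sahiE (fun q : α × β × Finset ι => wA q.1 * wB q.2.1 * w0 q.2.2) 3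
          ![fun q => f q.2.2 q.1, fun q => g q.2.2 q.2.1, fun q => h q.1 q.2.1] ≤
      sahiE (fun q : α × β × Finset ι => wA q.1 * wB q.2.1 * w q.2.2) 3
          ![fun q => f q.2.2 q.1, fun q => g q.2.2 q.2.1, fun q => h q.1 q.2.1] := by
  rw [sahiE_three_eq_pieces hA hB hf0 hh0 hfa hha w hws, sahiE_three_eq_pieces hA hB hf0 hh0 hfa hha w1 hw1s,
    sahiE_three_eq_pieces hA hB hf0 hh0 hfa hha w0 hw0s]
  -- the weight-free kernels
  set T : β → Finset ι → Finset ι → ℝ := fun b x y =>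
    g x b * ((2 - rho wA wB f h x) * Y wA f h x b - FC wA f y * HH wA h b - (1 - rho wA wB f h y) * Y wA f h y b) with hT
  set K : Finset ι → Finset ι → ℝ := fun x y =>
    (∑ b, wB b * (g y b * Y wA f h x b)) - GC wB g y * Ybar wA wB f h x with hK
  have hA0 := hA.nonneg
  have hB0 := hB.nonneg
  -- basic facts about the weight-free ingredients
  have hρ := fun c => SahiTriangleClassT.rho_spec (wB := wB) hA hB0 hf0 hh0 hfa hha c
  have hY0 : ∀ c b, 0 ≤ Y wA f h c b := fun c b =>
    sum_nonneg fun a _ => mul_nonneg (hA0 a) (mul_nonneg (hf0 c a) (hh0 a b))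
  have hYb : ∀ c, Monotone (Y wA f h c) := fun c b b' hbb =>
    sum_le_sum fun a _ => mul_le_mul_of_nonneg_left (mul_le_mul_of_nonneg_left (hhb a hbb) (hf0 c a)) (hA0 a)
  have hYc : ∀ b, Monotone (fun c => Y wA f h c b) := fun b c c' hcc =>
    sum_le_sum fun a _ => mul_le_mul_of_nonneg_left (mul_le_mul_of_nonneg_right (hfc a hcc) (hh0 a b)) (hA0 a)
  have hF0 : ∀ c, 0 ≤ FC wA f c := fun c => sum_nonneg fun a _ => mul_nonneg (hA0 a) (hf0 c a)
  have hFm : Monotone (FC wA f) := fun c c' hcc => sum_le_sum fun a _ => mul_le_mul_of_nonneg_left (hfc a hcc) (hA0 a)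
  have hH0 : ∀ b, 0 ≤ HH wA h b := fun b => sum_nonneg fun a _ => mul_nonneg (hA0 a) (hh0 a b)
  have hFH : ∀ c b, FC wA f c * HH wA h b ≤ Y wA f h c b := fun c b =>
    SahiTriangleClassT.FH_le_Y hA hf0 hh0 hfa hha c b
  have hstar : ∀ c c' : Finset ι, c' ≤ c → FC wA f c' ≤ (1 - rho wA wB f h c + rho wA wB f h c') * FC wA f c :=
    fun c c' hcc => SahiTriangleClassT.star hA hB0 hf0 hh0 hfa hfc hha hcc
  have hKnn : ∀ x y, 0 ≤ K x y := fun x y =>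
    sub_nonneg.mpr (SahiTriangleSupermodular.fkg_sum hB (hg0 y) (hY0 x) (hgb y) (hYb x))
  -- (A) the Φ-part: the difference is the mixed part, nonnegative by the polarised G3
  have eA : (∑ b, wB b * ∑ x, ∑ y, w x * w y * T b x y) - t ^ 2 * (∑ b, wB b * ∑ x, ∑ y, w1 x * w1 y * T b x y) -
        (1 - t) ^ 2 * (∑ b, wB b * ∑ x, ∑ y, w0 x * w0 y * T b x y) =
      ∑ b, wB b * ∑ x, ∑ y, (if e ∈ x ∪ y ∧ e ∉ x ∩ y then w x * w y else 0) * T b x y := by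
    rw [mul_sum, mul_sum, ← sum_sub_distrib, ← sum_sub_distrib]
    refine sum_congr rfl fun b _ => ?_
    rw [mul_left_comm, sq_mul_pairSum_top e t w w1 h1, mul_left_comm, sq_mul_pairSum_bottom e t w w0 h0,
      pairSum_split e w (T b)]
    ring
  have pA : 0 ≤ ∑ b, wB b * ∑ x, ∑ y, (if e ∈ x ∪ y ∧ e ∉ x ∩ y then w x * w y else 0) * T b x y := by
    refine sum_nonneg fun b _ => mul_nonneg (hB0 b) ?_
    rw [hT]
    exact SahiBox.phi_polarised_coord_mixed w hw0 hwmod e (F := FC wA f) (H := fun _ => HH wA h b)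
      (Y := fun c => Y wA f h c b) (r := rho wA wB f h) (g := fun c => g c b) hFm hF0 (fun _ _ _ => le_rfl)
      (fun _ => hH0 b) (hYc b) (fun c => hFH c b) (fun c => (hρ c).2.1) (fun c => (hρ c).2.2.1) hstar
      (fun c => hg0 c b) (hgc b)
  -- (B) the K-part (diagonal covariances)
  have eB : (∑ c, w c * (rho wA wB f h c * K c c)) - t ^ 2 * (∑ c, w1 c * (rho wA wB f h c * K c c)) -
        (1 - t) ^ 2 * (∑ c, w0 c * (rho wA wB f h c * K c c)) =
      ∑ c, (if e ∈ c then (1 - t) * w c else t * w c) * (rho wA wB f h c * K c c) := by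
    rw [pow_two, pow_two, mul_assoc, mul_linSum_top e t w w1 h1, mul_assoc, mul_linSum_bottom e t w w0 h0,
      mul_sum, mul_sum, ← sum_sub_distrib, ← sum_sub_distrib]
    refine sum_congr rfl fun c _ => ?_
    by_cases hc : e ∈ c
    · simp only [hc, if_true]; ring
    · simp only [hc, if_false]; ring
  have pB : 0 ≤ ∑ c, (if e ∈ c then (1 - t) * w c else t * w c) * (rho wA wB f h c * K c c) := by
    refine sum_nonneg fun c _ => mul_nonneg ?_ (mul_nonneg (hρ c).2.1 (hKnn c c))
    by_cases hc : e ∈ c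
    · rw [if_pos hc]; exact mul_nonneg (by linarith) (hw0 c)
    · rw [if_neg hc]; exact mul_nonneg ht0 (hw0 c)
  -- (C) the L-part (off-diagonal covariances)
  have eC : (∑ x, ∑ y, w x * w y * ((1 - rho wA wB f h x) * K x y)) -
        t ^ 2 * (∑ x, ∑ y, w1 x * w1 y * ((1 - rho wA wB f h x) * K x y)) -
        (1 - t) ^ 2 * (∑ x, ∑ y, w0 x * w0 y * ((1 - rho wA wB f h x) * K x y)) =
      ∑ x, ∑ y, (if e ∈ x ∪ y ∧ e ∉ x ∩ y then w x * w y else 0) * ((1 - rho wA wB f h x) * K x y) := by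
    rw [sq_mul_pairSum_top e t w w1 h1, sq_mul_pairSum_bottom e t w w0 h0,
      pairSum_split e w (fun x y => (1 - rho wA wB f h x) * K x y)]
    ring
  have pC : 0 ≤ ∑ x, ∑ y, (if e ∈ x ∪ y ∧ e ∉ x ∩ y then w x * w y else 0) * ((1 - rho wA wB f h x) * K x y) := by
    refine sum_nonneg fun x _ => sum_nonneg fun y _ => mul_nonneg ?_ ?_
    · split_ifs
      · exact mul_nonneg (hw0 x) (hw0 y)
      · exact le_rfl
    · exact mul_nonneg (by linarith [(hρ x).2.2.1]) (hKnn x y)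
  nlinarith [eA, eB, eC, pA, pB, pC]

end ClassT


end SahiClassTLambdaTwo

end Summit.CriticalPhenomena.PercolationContinuityZ3.Theorems
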